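import Summits.AtomisticToContinuum.Crystallization.Theorems.ChargedEnergyGap.Negative.BlocksEnergy
import Summits.AtomisticToContinuum.Crystallization.Theorems.ThreeConeCertificateExactCertificateInvisibilitySlice
import Summits.AtomisticToContinuum.Crystallization.Theorems.ThreeConeCertificateExactCertificateInvisibilityRadial
import Summits.AtomisticToContinuum.Crystallization.Theorems.ThreeConeCertificateExactCertificateInvisibilityJensen
import Summits.AtomisticToContinuum.Crystallization.Theorems.ThreeConeCertificateExactCertificateInvisibilityCoincidence
import Summits.AtomisticToContinuum.Crystallization.Theorems.ThreeConeCertificateExactCertificateInvisibilityNorms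
import Summits.AtomisticToContinuum.Crystallization.Theorems.ThreeConeCertificateExactCertificateInvisibilityOneDim
import Summits.AtomisticToContinuum.Crystallization.Theorems.ThreeConeCertificateExactCertificateInvisibilityBragg
import Summits.AtomisticToContinuum.Crystallization.Theorems.BraggSlacknessRigidityStrictCertificateBraggHcp
import HarnessLib

/-!
# Crux `ExactCertificate` (stmt-AtomisticToContinuum-11959), line `closure-makes-nogap-exact`, skeleton VIII:
# THE INVISIBILITY DICHOTOMY — no finite-range radial kernel is invisible to a 3-D crystal; in d = 1 such kernels exist

Support file for the crux `ThreeConeCertificate.ExactCertificate` (registered assembly stub `stub_invisibilityAssembly` =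
the deciding statement `Cruxes.ExactCertificate.Invisibility.InvisibilityDichotomy` of skeleton VIII).  Nothing here
closes the 3-D crux, which stays `NoGap ∧ KeplerBound` (`Split.ExactCertificate_iff_subs`, `KeplerBound` = item 11961 ↔
0627 open).  What this file proves is the first unconditional theorem ON THE FAR-FIELD WALL W1 of the crux dossier
(`Cruxes/ExactCertificate/STRATEGY-CENSUS.md` §2a(α), `TRANSFER-1D-CLASS.md` §2): the d = 1 exactness mechanism of the
Transfer lane (c6–c9: `f = −¼Δ_aΨ_a = α ∗ Ψ_a` with `α = −¼(δ_a − 2δ₀ + δ_{−a})` a FINITE-RANGE kernel INVISIBLE to the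
chain, `α̂ = −sin²(πaξ)` vanishing on the dual lattice) has NO counterpart in `ℝ³`, for ANY lattice:

* `entire_eq_zero_of_vanish_on_latticeNorms` (the engine): an entire function of exponential type that vanishes at
  `‖n k₁ + j k₂‖` for all `(n, j) ≠ (0, 0)`, `k₁, k₂ ∈ ℝ³` independent, is identically zero — the zeros are
  SUPERLINEAR in the radius (`stub_normsSuperlinear` + `stub_coincidenceFinite`: J parallel lattice lines are each at most
  2-to-1 and two distinct lines share finitely many norms), a nonzero function of exponential type has `O(R)` zeros
  (`stub_jensenCount`, Jensen's inequality `AnalyticOnNhd.sum_divisor_le`).  No arithmetic of the lattice is used.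
* `radial_eq_zero_of_fourier_vanish`: a continuous `α : ℝ → ℝ` vanishing on `[L, ∞)` whose radial kernel `A = α∘‖·‖`
  on `ℝ³` has `𝓕A (n k₁ + j k₂) = 0` for all `(n, j) ≠ (0, 0)` is `≡ 0` on `[0, ∞)` (slice `s ↦ 𝓕A(s e₀)` is entire
  of exponential type, `stub_sliceEntire`; radiality `stub_fourierRadial`; Fourier inversion).
* `noInvisibleKernel_of_structureFactor_ne_zero`: for EVERY periodic configuration `P ⊂ ℝ³` and every such `α` whose
  field `Σ_{y ∈ P} α(dist w y)` vanishes at every `w`: if the motif structure factor `S_P` does not vanish on some lattice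
  plane `{n k₁ + j k₂}` of dual vectors (`k₁, k₂` independent), then `α ≡ 0` on `[0, ∞)` (`stub_braggOfInvisible`:
  invisibility ⇒ `S_P(k) 𝓕A(k) = 0` on the dual lattice).
* `bravais_noInvisibleKernel`: in particular NO nonzero finite-range continuous radial kernel is invisible to a Bravais
  crystal (one-point motif: `S_P` never vanishes; two independent dual vectors always exist, `exists_dualVectors`);
  `commensurate_noInvisibleKernel`: nor to ANY periodic crystal with a commensurate motif (`q(x − x') ∈ G` for motif
  points `x, x'`: `S_P(qk) = #motif · e^{−2πi⟨x₀,qk⟩} ≠ 0`), e.g. `hcp_noInvisibleKernel` (hexagonal close packing,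
  `q = 6`: `6(w + h e₃) = 2(u + v) + 3(2h e₃)`) and `fcc_noInvisibleKernel` — the two templates of the crux dossier.
* `stub_invisibilityAssembly` (registered) = `InvisibilityDichotomy`: the Bravais statement ∧ the d = 1 EXISTENCE of
  such kernels for every spacing `a > 0` (`stub_oneDimKernel`: `T_a − ½(T_a(· − a/2) + T_a(· + a/2))`, tents tile `aℤ`).

Reading for the crux: an exact three-cone certificate in `ℝ³` cannot be produced by the d = 1 recipe "finite-range
invisible kernel convolved with a retarded Green's function" at ANY template — the far-field interpolant `f`, if it
exists, is NOT of the form `α ∗ Ψ` with `α` radial, continuous, of finite range and invisible; in d = 1 it is exactly of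
that form.  All `[folklore]` (Paley–Wiener/Jensen zero counting; the statement itself does not seem to be in print).
-/

noncomputable section

namespace Summit.AtomisticToContinuum.Crystallization.Theorems.ThreeConeCertificateExactCertificate.Invisibility

open Literature.MathematicalPhysics.StatisticalMechanics MeasureTheory Set Filter Topology
open Summit.AtomisticToContinuum.Crystallization.Theorems.ChargedEnergyGapNegative (E3)
open Summit.AtomisticToContinuum.Crystallization.Theorems.ChargedEnergyGapNegative.Blocks (zBasis)
open scoped BigOperators FourierTransform RealInnerProductSpace

/-! ## Two independent dual vectors of a full-rank lattice of `ℝ³` -/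

/-- Every periodic configuration of `ℝ³` has two linearly independent DUAL vectors `k₁, k₂` (`⟪kᵢ, g⟫ ∈ ℤ` for every
period `g`): the first two vectors of the basis dual, for the inner product, to a `ℤ`-basis of the lattice. [folklore] -/
theorem exists_dualVectors (P : PeriodicConfiguration 3) :
    ∃ k₁ k₂ : E3, LinearIndependent ℝ ![k₁, k₂] ∧
      (∀ g ∈ P.lattice, ∃ n : ℤ, ⟪k₁, g⟫ = (n : ℝ)) ∧ (∀ g ∈ P.lattice, ∃ n : ℤ, ⟪k₂, g⟫ = (n : ℝ)) := by
  set b : Module.Basis (Fin 3) ℝ E3 := (zBasis P).ofZLatticeBasis ℝ P.lattice with hb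
  set k : Fin 3 → E3 := fun i =>
    (InnerProductSpace.toDual ℝ E3).symm (LinearMap.toContinuousLinearMap (b.coord i)) with hk
  have hkv : ∀ (i : Fin 3) (v : E3), ⟪k i, v⟫ = b.repr v i := by
    intro i v
    rw [hk]
    simp only [InnerProductSpace.toDual_symm_apply, LinearMap.coe_toContinuousLinearMap', Module.Basis.coord_apply]
  have hkint : ∀ (i : Fin 3), ∀ g ∈ P.lattice, ∃ n : ℤ, ⟪k i, g⟫ = (n : ℝ) := by
    intro i g hg
    refine ⟨(zBasis P).repr ⟨g, hg⟩ i, ?_⟩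
    rw [hkv, hb]
    exact Module.Basis.ofZLatticeBasis_repr_apply ℝ P.lattice (zBasis P) ⟨g, hg⟩ i
  have hkb : ∀ i i' : Fin 3, ⟪k i, b i'⟫ = if i' = i then 1 else 0 := by
    intro i i'
    rw [hkv, b.repr_self, Finsupp.single_apply]
  refine ⟨k 0, k 1, ?_, hkint 0, hkint 1⟩
  rw [LinearIndependent.pair_iff]
  intro s t hst
  have h0 := congrArg (fun v => ⟪v, b 0⟫) hst
  have h1 := congrArg (fun v => ⟪v, b 1⟫) hst
  simp only [inner_add_left, real_inner_smul_left, hkb, inner_zero_left] at h0 h1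
  simp at h0 h1
  exact ⟨h0, h1⟩

/-! ## The engine: an entire function of exponential type vanishing on the norms of a rank-2 lattice is zero -/

/-- **Engine.** An entire `Φ` of exponential type that vanishes at `‖n k₁ + j k₂‖` for all `(n, j) ≠ (0, 0)`
(`k₁, k₂ ∈ ℝ³` independent) vanishes identically: the zeros are superlinear in the radius
(`stub_coincidenceFinite`, `stub_normsSuperlinear`), a nonzero `Φ` has `O(R)` of them (`stub_jensenCount`). [folklore] -/
theorem entire_eq_zero_of_vanish_on_latticeNorms (Φ : ℂ → ℂ) (hΦ : Differentiable ℂ Φ) {B τ : ℝ}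
    (hB : ∀ z : ℂ, ‖Φ z‖ ≤ B * Real.exp (τ * ‖z‖)) {k₁ k₂ : E3} (hli : LinearIndependent ℝ ![k₁, k₂])
    (hz : ∀ n j : ℤ, (n, j) ≠ (0, 0) → Φ (‖(n : ℝ) • k₁ + (j : ℝ) • k₂‖ : ℂ) = 0) : ∀ z : ℂ, Φ z = 0 := by
  by_contra h
  rw [not_forall] at h
  obtain ⟨c, hc⟩ := h
  obtain ⟨C₁, C₂, hcount⟩ := stub_jensenCount Φ B τ c hΦ hB hc
  obtain ⟨R, Z, hR, hcard, hZ⟩ := stub_normsSuperlinear stub_coincidenceFinite k₁ k₂ hli C₁ C₂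
  have h1 := hcount R (Z.image fun s : ℝ => (s : ℂ)) hR ?_
  · rw [Finset.card_image_of_injective _ Complex.ofReal_injective] at h1
    linarith
  · intro z hz'
    obtain ⟨s, hs, rfl⟩ := Finset.mem_image.1 hz'
    obtain ⟨hsR, n, j, hnj, rfl⟩ := hZ s hs
    refine ⟨?_, hz n j hnj⟩
    rw [Complex.norm_real, Real.norm_eq_abs, abs_of_nonneg (norm_nonneg _)]
    exact hsR

/-! ## No finite-range continuous radial kernel has Fourier transform vanishing on a lattice plane -/

/-- The unit vector of the first axis (local notation). -/
local notation "e₀" => (EuclideanSpace.single (0 : Fin 3) (1 : ℝ) : EuclideanSpace ℝ (Fin 3))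

/-- `‖s e₀‖ = s` for `s ≥ 0`. [folklore] -/
theorem norm_smul_single_zero_one {s : ℝ} (hs : 0 ≤ s) : ‖s • e₀‖ = s := by
  rw [norm_smul, Real.norm_eq_abs, abs_of_nonneg hs]
  simp

/-- A continuous radial profile vanishing on `[L, ∞)` gives a continuous, integrable kernel `A = α∘‖·‖` on `ℝ³`
vanishing outside the `L`-ball. [folklore] -/
theorem radialKernel_props (α : ℝ → ℝ) (L : ℝ) (hα : Continuous α) (hL : ∀ r : ℝ, L ≤ r → α r = 0) :
    Continuous (fun v : E3 => (α ‖v‖ : ℂ)) ∧ Integrable (fun v : E3 => (α ‖v‖ : ℂ)) ∧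
      ∀ v : E3, L < ‖v‖ → (α ‖v‖ : ℂ) = 0 := by
  have hc : Continuous fun v : E3 => (α ‖v‖ : ℂ) :=
    Complex.continuous_ofReal.comp (hα.comp continuous_norm)
  have hsupp : ∀ v : E3, L < ‖v‖ → (α ‖v‖ : ℂ) = 0 := fun v hv => by
    rw [hL _ hv.le, Complex.ofReal_zero]
  have hcs : HasCompactSupport fun v : E3 => (α ‖v‖ : ℂ) := by
    refine HasCompactSupport.of_support_subset_isCompact (isCompact_closedBall (0 : E3) L) ?_
    intro v hv
    rw [Metric.mem_closedBall, dist_zero_right]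
    by_contra h
    exact hv (hsupp v (not_le.1 h))
  exact ⟨hc, hc.integrable_of_hasCompactSupport hcs, hsupp⟩

/-- **No finite-range continuous radial kernel on `ℝ³` has Fourier transform vanishing on a lattice plane minus the
origin.**  If `α` is continuous, vanishes on `[L, ∞)`, and `𝓕(α∘‖·‖)(n k₁ + j k₂) = 0` for all `(n, j) ≠ (0, 0)` with
`k₁, k₂ ∈ ℝ³` independent, then `α ≡ 0` on `[0, ∞)` (slice entire of exponential type + radiality + the engine +
Fourier inversion). [folklore] -/
theorem radial_eq_zero_of_fourier_vanish (α : ℝ → ℝ) (L : ℝ) (hα : Continuous α)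
    (hL : ∀ r : ℝ, L ≤ r → α r = 0) {k₁ k₂ : E3} (hli : LinearIndependent ℝ ![k₁, k₂])
    (hz : ∀ n j : ℤ, (n, j) ≠ (0, 0) →
      𝓕 (fun v : E3 => (α ‖v‖ : ℂ)) ((n : ℝ) • k₁ + (j : ℝ) • k₂) = 0) :
    ∀ r : ℝ, 0 ≤ r → α r = 0 := by
  obtain ⟨hAc, hAi, hAsupp⟩ := radialKernel_props α L hα hL
  obtain ⟨Φ, hΦd, ⟨B, τ, hB⟩, hΦF⟩ := stub_sliceEntire (fun v : E3 => (α ‖v‖ : ℂ)) L hAi hAsupp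
  have hrad := stub_fourierRadial (fun r : ℝ => (α r : ℂ))
  -- zeros of `Φ` at the lattice norms
  have hzΦ : ∀ n j : ℤ, (n, j) ≠ (0, 0) → Φ (‖(n : ℝ) • k₁ + (j : ℝ) • k₂‖ : ℂ) = 0 := by
    intro n j hnj
    rw [hΦF ‖(n : ℝ) • k₁ + (j : ℝ) • k₂‖, hrad _ ((n : ℝ) • k₁ + (j : ℝ) • k₂)
      (norm_smul_single_zero_one (norm_nonneg _))]
    exact hz n j hnj
  have hΦ0 := entire_eq_zero_of_vanish_on_latticeNorms Φ hΦd hB hli hzΦ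
  -- `𝓕A ≡ 0`
  have hFA : 𝓕 (fun v : E3 => (α ‖v‖ : ℂ)) = 0 := by
    funext ξ
    rw [hrad ξ (‖ξ‖ • e₀) (by rw [norm_smul_single_zero_one (norm_nonneg _)]), Pi.zero_apply, ← hΦF, hΦ0]
  -- Fourier inversion
  have hinv := hAc.fourierInv_fourier_eq hAi (by rw [hFA]; exact integrable_zero _ _ _)
  rw [hFA] at hinv
  intro r hr
  have hv := congrFun hinv (r • e₀)
  rw [Real.fourierInv_eq'] at hv
  simp only [Pi.zero_apply, smul_zero, integral_zero] at hv
  rw [norm_smul_single_zero_one hr] at hv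
  exact_mod_cast hv.symm

/-! ## Crystals: invisibility along an extinction-free reciprocal plane forces the kernel to vanish -/

/-- **No finite-range continuous radial kernel is invisible to a periodic crystal of `ℝ³` along an extinction-free
reciprocal plane.**  Let `P` be ANY periodic configuration of `ℝ³`, `α : ℝ → ℝ` continuous and vanishing on `[L, ∞)`,
with vanishing field `Σ_{y ∈ P} α(dist w y) = 0` at every `w ∈ ℝ³`.  If `k₁, k₂` are independent dual vectors
(`⟪kᵢ, g⟫ ∈ ℤ` for all periods `g`) on whose plane the motif structure factor never vanishes,
`Σ_{x ∈ motif} e^{−2πi⟨x, n k₁ + j k₂⟩} ≠ 0` for `(n, j) ≠ (0, 0)`, then `α ≡ 0` on `[0, ∞)`.  (For a one-point motif the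
structure factor is a unimodular exponential and the hypothesis is automatic — `bravais_noInvisibleKernel`; for the
hexagonal close packing it holds on the basal reciprocal plane.) [folklore] -/
theorem noInvisibleKernel_of_structureFactor_ne_zero (P : PeriodicConfiguration 3) (α : ℝ → ℝ) (L : ℝ)
    (hα : Continuous α) (hL : ∀ r : ℝ, L ≤ r → α r = 0)
    (hinv : ∀ w : E3, HasSum (fun y : P.points => α (dist w (y : E3))) 0)
    {k₁ k₂ : E3} (hli : LinearIndependent ℝ ![k₁, k₂])
    (hk₁ : ∀ g ∈ P.lattice, ∃ n : ℤ, ⟪k₁, g⟫ = (n : ℝ)) (hk₂ : ∀ g ∈ P.lattice, ∃ n : ℤ, ⟪k₂, g⟫ = (n : ℝ))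
    (hS : ∀ n j : ℤ, (n, j) ≠ (0, 0) →
      (∑ x ∈ P.motif, Complex.exp (↑(-2 * Real.pi * ⟪x, (n : ℝ) • k₁ + (j : ℝ) • k₂⟫) * Complex.I)) ≠ 0) :
    ∀ r : ℝ, 0 ≤ r → α r = 0 := by
  obtain ⟨-, hAi, -⟩ := radialKernel_props α L hα hL
  refine radial_eq_zero_of_fourier_vanish α L hα hL hli fun n j hnj => ?_
  have hdual : ∀ g ∈ P.lattice, ∃ m : ℤ, ⟪(n : ℝ) • k₁ + (j : ℝ) • k₂, g⟫ = (m : ℝ) := by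
    intro g hg
    obtain ⟨p, hp⟩ := hk₁ g hg
    obtain ⟨q, hq⟩ := hk₂ g hg
    refine ⟨n * p + j * q, ?_⟩
    rw [inner_add_left, real_inner_smul_left, real_inner_smul_left, hp, hq]
    push_cast
    ring
  have h := stub_braggOfInvisible P α L hL hAi hinv _ hdual
  exact (mul_eq_zero.1 h).resolve_left (hS n j hnj)

/-- **No finite-range continuous radial kernel is invisible to a Bravais crystal of `ℝ³`.**  For a periodic
configuration with a one-point motif, every continuous `α` vanishing on `[L, ∞)` whose field `Σ_{y ∈ P} α(dist w y)`
vanishes at every `w` is `≡ 0` on `[0, ∞)`.  Contrast: in d = 1 such kernels exist for every chain (`stub_oneDimKernel`),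
and they are the mechanism of the d = 1 exact certificates (Transfer I–VII). [folklore] -/
theorem bravais_noInvisibleKernel (P : PeriodicConfiguration 3) (hP : P.motif.card = 1) (α : ℝ → ℝ) (L : ℝ)
    (hα : Continuous α) (hL : ∀ r : ℝ, L ≤ r → α r = 0)
    (hinv : ∀ w : E3, HasSum (fun y : P.points => α (dist w (y : E3))) 0) :
    ∀ r : ℝ, 0 ≤ r → α r = 0 := by
  obtain ⟨k₁, k₂, hli, hk₁, hk₂⟩ := exists_dualVectors P
  obtain ⟨x₀, hx₀⟩ := Finset.card_eq_one.1 hP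
  refine noInvisibleKernel_of_structureFactor_ne_zero P α L hα hL hinv hli hk₁ hk₂ fun n j _ => ?_
  rw [hx₀, Finset.sum_singleton]
  exact Complex.exp_ne_zero _

/-- **No finite-range continuous radial kernel is invisible to a crystal with COMMENSURATE motif.**  If some positive
integer `q` takes every difference of motif points into the lattice of periods, then every continuous `α` vanishing on
`[L, ∞)` whose field on the crystal vanishes identically is `≡ 0` on `[0, ∞)`: on the dilated dual plane
`{n (q k₁) + j (q k₂)}` the structure factor is `#motif · e^{−2πi⟨x₀, ·⟩} ≠ 0`. [folklore] -/
theorem commensurate_noInvisibleKernel (P : PeriodicConfiguration 3) {q : ℕ} (hq : 0 < q)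
    (hcomm : ∀ x ∈ P.motif, ∀ x' ∈ P.motif, (q : ℝ) • (x - x') ∈ P.lattice) (α : ℝ → ℝ) (L : ℝ)
    (hα : Continuous α) (hL : ∀ r : ℝ, L ≤ r → α r = 0)
    (hinv : ∀ w : E3, HasSum (fun y : P.points => α (dist w (y : E3))) 0) :
    ∀ r : ℝ, 0 ≤ r → α r = 0 := by
  obtain ⟨k₁, k₂, hli, hk₁, hk₂⟩ := exists_dualVectors P
  obtain ⟨x₀, hx₀⟩ := P.motif_nonempty
  have hq0 : (q : ℝ) ≠ 0 := by exact_mod_cast hq.ne'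
  -- the dilated dual vectors
  have hli' : LinearIndependent ℝ ![(q : ℝ) • k₁, (q : ℝ) • k₂] := by
    rw [LinearIndependent.pair_iff] at hli ⊢
    intro s t hst
    have h := hli (s * q) (t * q) (by rw [mul_smul, mul_smul]; exact hst)
    exact ⟨(mul_eq_zero.1 h.1).resolve_right hq0, (mul_eq_zero.1 h.2).resolve_right hq0⟩
  have hdual' : ∀ (k : E3), (∀ g ∈ P.lattice, ∃ n : ℤ, ⟪k, g⟫ = (n : ℝ)) →
      ∀ g ∈ P.lattice, ∃ n : ℤ, ⟪(q : ℝ) • k, g⟫ = (n : ℝ) := by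
    intro k hk g hg
    obtain ⟨n, hn⟩ := hk g hg
    exact ⟨q * n, by rw [real_inner_smul_left, hn]; push_cast; ring⟩
  refine noInvisibleKernel_of_structureFactor_ne_zero P α L hα hL hinv hli' (hdual' k₁ hk₁) (hdual' k₂ hk₂)
    fun n j _ => ?_
  -- the structure factor on the dilated plane: every phase equals the phase of `x₀`
  set k : E3 := (n : ℝ) • k₁ + (j : ℝ) • k₂ with hkdef
  have hkdual : ∀ g ∈ P.lattice, ∃ m : ℤ, ⟪k, g⟫ = (m : ℝ) := by
    intro g hg
    obtain ⟨p₁, hp₁⟩ := hk₁ g hg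
    obtain ⟨p₂, hp₂⟩ := hk₂ g hg
    refine ⟨n * p₁ + j * p₂, ?_⟩
    rw [hkdef, inner_add_left, real_inner_smul_left, real_inner_smul_left, hp₁, hp₂]
    push_cast
    ring
  have hqk : (n : ℝ) • ((q : ℝ) • k₁) + (j : ℝ) • ((q : ℝ) • k₂) = (q : ℝ) • k := by
    rw [hkdef, smul_add, smul_comm (n : ℝ) (q : ℝ) k₁, smul_comm (j : ℝ) (q : ℝ) k₂]
  have hphase : ∀ x ∈ P.motif,
      Complex.exp (↑(-2 * Real.pi * ⟪x, (q : ℝ) • k⟫) * Complex.I) =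
        Complex.exp (↑(-2 * Real.pi * ⟪x₀, (q : ℝ) • k⟫) * Complex.I) := by
    intro x hx
    obtain ⟨m, hm⟩ := hkdual _ (hcomm x hx x₀ hx₀)
    have hxq : ⟪x, (q : ℝ) • k⟫ = ⟪x₀, (q : ℝ) • k⟫ + m := by
      have h1 : ⟪(q : ℝ) • (x - x₀), k⟫ = ⟪x, (q : ℝ) • k⟫ - ⟪x₀, (q : ℝ) • k⟫ := by
        rw [real_inner_smul_left, inner_sub_left, real_inner_smul_right, real_inner_smul_right]
        ring
      rw [real_inner_comm] at hm
      linarith [hm, h1]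
    rw [hxq, show ((-2 * Real.pi * (⟪x₀, (q : ℝ) • k⟫ + (m : ℝ)) : ℝ) : ℂ) * Complex.I =
        ↑(-2 * Real.pi * ⟪x₀, (q : ℝ) • k⟫) * Complex.I + ((-m : ℤ) : ℂ) * (2 * Real.pi * Complex.I) by
      push_cast; ring, Complex.exp_add, Complex.exp_int_mul_two_pi_mul_I, mul_one]
  rw [hqk, Finset.sum_congr rfl hphase, Finset.sum_const, nsmul_eq_mul]
  exact mul_ne_zero (by exact_mod_cast (Finset.card_pos.2 ⟨x₀, hx₀⟩).ne') (Complex.exp_ne_zero _)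

/-- **The hexagonal close packing admits no finite-range continuous radial invisible kernel** (the expected
Lennard-Jones template of the dossier; motif `{0, w + h e₃}` is commensurate with `q = 6`, since `3w = u + v` and `2h e₃`
is a period). [folklore] -/
theorem hcp_noInvisibleKernel {a h : ℝ} (ha : a ≠ 0) (hh : h ≠ 0) (α : ℝ → ℝ) (L : ℝ)
    (hα : Continuous α) (hL : ∀ r : ℝ, L ≤ r → α r = 0)
    (hinv : ∀ w : E3, HasSum (fun y : (hcpPeriodicConfiguration ha hh).points => α (dist w (y : E3))) 0) :
    ∀ r : ℝ, 0 ≤ r → α r = 0 := by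
  refine commensurate_noInvisibleKernel (hcpPeriodicConfiguration ha hh) (q := 6) (by norm_num) ?_ α L hα hL hinv
  obtain ⟨hu, hv, h2⟩ := BraggSlacknessRigidityStrictCertificate.hcp_periods_mem ha hh
  obtain ⟨h0, h1⟩ := BraggSlacknessRigidityStrictCertificate.hcp_barlowPos_zero_one a h
  -- `6 (w + h e₃) = 2 (u + v) + 3 (2 h e₃)` is a period
  have hper : (6 : ℝ) • (barlowOffset a + layerNormal h) ∈ (hcpPeriodicConfiguration ha hh).lattice := by
    have h3w := three_smul_barlowOffset a
    have : (6 : ℝ) • (barlowOffset a + layerNormal h) =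
        (2 : ℝ) • (triangularVec₁ a + triangularVec₂ a) + (3 : ℝ) • ((2 : ℝ) • layerNormal h) := by
      rw [← h3w, smul_smul, smul_smul, smul_add]; norm_num
    rw [this]
    refine (hcpPeriodicConfiguration ha hh).lattice.add_mem ?_ ?_
    · rw [show (2 : ℝ) • (triangularVec₁ a + triangularVec₂ a) =
          ((2 : ℤ) : ℝ) • (triangularVec₁ a + triangularVec₂ a) by norm_num, Int.cast_smul_eq_zsmul]
      exact Submodule.smul_mem _ _ (Submodule.add_mem _ hu hv)
    · rw [show (3 : ℝ) • ((2 : ℝ) • layerNormal h) = ((3 : ℤ) : ℝ) • ((2 : ℝ) • layerNormal h) by norm_num,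
        Int.cast_smul_eq_zsmul]
      exact Submodule.smul_mem _ _ h2
  -- the motif is `{0, w + h e₃}`
  intro x hx x' hx'
  rw [BraggSlacknessRigidityStrictCertificate.hcp_motif_eq, Finset.mem_image] at hx hx'
  obtain ⟨m, hm, rfl⟩ := hx
  obtain ⟨m', hm', rfl⟩ := hx'
  have hcases : ∀ m ∈ Finset.range 2, barlowPos a h alternatingHagg m 0 0 = 0 ∨
      barlowPos a h alternatingHagg m 0 0 = barlowOffset a + layerNormal h := by
    intro m hm
    have hm2 := Finset.mem_range.1 hm
    interval_cases m
    · exact Or.inl (by exact_mod_cast h0)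
    · exact Or.inr (by exact_mod_cast h1)
  have hneg : (6 : ℝ) • (-(barlowOffset a + layerNormal h)) ∈ (hcpPeriodicConfiguration ha hh).lattice := by
    rw [smul_neg]; exact Submodule.neg_mem _ hper
  rcases hcases m hm with e | e <;> rcases hcases m' hm' with e' | e' <;> rw [e, e']
  · simp
  · simpa using hneg
  · simpa using hper
  · simp

/-- **Nor does the face-centred cubic stacking** (a Bravais configuration: one-point motif). [folklore] -/
theorem fcc_noInvisibleKernel {a h : ℝ} (ha : a ≠ 0) (hh : h ≠ 0) (α : ℝ → ℝ) (L : ℝ)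
    (hα : Continuous α) (hL : ∀ r : ℝ, L ≤ r → α r = 0)
    (hinv : ∀ w : E3, HasSum (fun y : (fccPeriodicConfiguration ha hh).points => α (dist w (y : E3))) 0) :
    ∀ r : ℝ, 0 ≤ r → α r = 0 :=
  bravais_noInvisibleKernel (fccPeriodicConfiguration ha hh) (by rfl) α L hα hL hinv

/-- **Registered assembly stub `stub_invisibilityAssembly` = the deciding statement `InvisibilityDichotomy` of skeleton
VIII: THE INVISIBILITY DICHOTOMY.**  (d = 3) For every Bravais periodic configuration `P ⊂ ℝ³`, every continuous
`α : ℝ → ℝ` vanishing on `[L, ∞)` whose field on the crystal vanishes identically is `≡ 0` on `[0, ∞)`.  (d = 1) For every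
`a > 0` there is a continuous `α` with `α 0 ≠ 0`, vanishing on `[L, ∞)`, whose field on the chain `aℤ` vanishes
identically. [folklore] -/
theorem stub_invisibilityAssembly :
    (∀ (P : Literature.MathematicalPhysics.StatisticalMechanics.PeriodicConfiguration 3) (α : ℝ → ℝ) (L : ℝ),
      P.motif.card = 1 → Continuous α → (∀ r : ℝ, L ≤ r → α r = 0) →
      (∀ w : EuclideanSpace ℝ (Fin 3),
        HasSum (fun y : P.points => α (dist w (y : EuclideanSpace ℝ (Fin 3)))) 0) →
      ∀ r : ℝ, 0 ≤ r → α r = 0) ∧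
    (∀ a : ℝ, 0 < a → ∃ (α : ℝ → ℝ) (L : ℝ), Continuous α ∧ α 0 ≠ 0 ∧
      (∀ r : ℝ, L ≤ r → α r = 0) ∧ ∀ w : ℝ, HasSum (fun n : ℤ => α |w - n * a|) 0) :=
  ⟨fun P α L hP hα hL hinv => bravais_noInvisibleKernel P hP α L hα hL hinv, stub_oneDimKernel⟩

end Summit.AtomisticToContinuum.Crystallization.Theorems.ThreeConeCertificateExactCertificate.Invisibility

end
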